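import Summits.QuantumFields.QCD.Theses.NestedDissectionSea
import Summits.QuantumFields.QCD.Theorems.NestedDissectionSeaKineticEdge

/-!
# Sketch — crux-ideate stmt-QuantumFields-14759 (`CoerciveOfDilute`), round 1, ideator 2

First lemmas of the three idea cards, as `def … : Prop` over tree vocabulary (they need not be
proved here; they must elaborate). Namespace `…Cruxes.CoerciveOfDilute.Ideator2`.

* Card A `sheet-sweep-translation`: `SeparatorIsMidSheets`, `SheetSweepBoxCount`,
  `SheetSweepCount`, `SheetSweepMarkov`, `PhaseQuenchedTranslationInvariance`.
* Card B `coherent-roughness`: `IsAlignedAt`, `AlignedLinkMonotone`.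
* Card C `valence-mass-fubini`: `IsolatedSignChangeOwnsInterval`, `SignDefectIffSepFactorNeg`,
  `IntegratedDilutionVanishes`.
-/

noncomputable section

open scoped BigOperators ComplexConjugate Classical
open MeasureTheory Filter Matrix
open Literature.MathematicalPhysics Literature.MathematicalPhysics.QuantumLattice
  Literature.MathematicalPhysics.QuantumFieldTheory Literature.Probability.LatticeModels

namespace Summit.QuantumFields.QCD.Cruxes.CoerciveOfDilute.Ideator2

/-- Local shorthand: the colour group `SU(3)`. -/
local notation "𝔾" => Matrix.specialUnitaryGroup (Fin 3) ℂ

/-! ## Card A — `sheet-sweep-translation` -/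

/-- A torus site lies on the INTERNAL SEPARATOR of the box `(x, s)`: it is in the open box and one
of its offsets takes the mid value `⌊s_i/2⌋` (the four one-site mid-sheets of nested dissection). -/
def OnSeparator {N : ℕ} (x : TorusSite 4 N) (s : Fin 4 → ℕ) (y : TorusSite 4 N) : Prop :=
  siteBox x s y ∧ ∃ i, (y i - x i).val = s i / 2

/-- **A1 — the separator is the four mid-sheets.** For the corner-`0` box with `s_i ≤ N`, a point
of the box is outside every child interior iff one of its offsets equals `⌊s_i/2⌋`
(children occupy the offset ranges `(0, ⌊s_i/2⌋)` / `(⌊s_i/2⌋, s_i)` in each direction; if every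
direction admits a half, the product choice `ε` is a child containing the point). Provable now. -/
def SeparatorIsMidSheets : Prop :=
  ∀ (N : ℕ) [NeZero N] (s : Fin 4 → ℕ), (∀ i, s i ≤ N) →
    ∀ p : {p // wilsonBox (0 : TorusSite 4 N) s p},
      (¬ childrenInterior s p ↔ ∃ i, (p.1.1 i).val = s i / 2)

/-- **A2a — box sweep count.** Each torus site lies in exactly `∏_j (s_j − 1)` translates of the
open box of sides `s` (`2 ≤ s_j ≤ N`). Provable now (offsets range freely over `(0, s_j)`). -/
def SheetSweepBoxCount : Prop :=
  ∀ (N : ℕ) [NeZero N] (s : Fin 4 → ℕ), (∀ i, 2 ≤ s i ∧ s i ≤ N) → ∀ y : TorusSite 4 N,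
    (Finset.univ.filter fun x : TorusSite 4 N => siteBox x s y).card = ∏ j, (s j - 1)

/-- **A2b — sheet sweep count.** Each torus site lies on the internal separator of at most
`Σ_i ∏_{j ≠ i} (s_j − 1)` translates of the box: being on the `i`-th mid-sheet fixes the `i`-th
offset and leaves the other three free. Hence, averaged over the `∏_j (s_j − 1)` translates that
contain it, a site is a separator site with frequency `Σ_i 1/(s_i − 1) ≤ 4/(min_i s_i − 1)`:
THE SHEET WEIGHT OF ANY FIXED VECTOR, AVERAGED OVER BOX TRANSLATES, IS `≈ 4/s₀`. Provable now. -/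
def SheetSweepCount : Prop :=
  ∀ (N : ℕ) [NeZero N] (s : Fin 4 → ℕ), (∀ i, 2 ≤ s i ∧ s i ≤ N) → ∀ y : TorusSite 4 N,
    ((Finset.univ.filter fun x : TorusSite 4 N => OnSeparator x s y).card : ℝ) ≤
      ∑ i : Fin 4, ∏ j ∈ Finset.univ.erase i, ((s j : ℝ) - 1)

/-- **A3 — Markov over positions (the lever's first inequality).** For every vector `u` on the
torus (site × colour × spin) and every threshold `W > 0`, the number of box translates whose
internal separator carries more than `W` of `‖u‖²` is at most `(Σ_i ∏_{j≠i}(s_j − 1)) ‖u‖² / W`: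
summing A2b against `‖u p‖²` and Markov. With `W = s₀|ev|/(4t)` (the single-carrier resonance
threshold of the landed pile-up lemma) this is the factor `16 t/(s₀² |ev|) · s₀⁴ / (…)` — i.e. the
sheet weight of a carrier becomes the PROBABILITY `≤ 4ρ/s₀` that a mid-sheet cuts it, and the
mass resolution at which its crossing must sit coarsens from `t a_k²/ℓ'²` to `≍ t a_k/ρ`.
Provable now. -/
def SheetSweepMarkov : Prop :=
  ∀ (N : ℕ) [NeZero N] (s : Fin 4 → ℕ), (∀ i, 2 ≤ s i ∧ s i ≤ N) →
    ∀ (u : TorusSite 4 N × Fin 3 × Fin 4 → ℂ) (W : ℝ), 0 < W →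
      ((Finset.univ.filter fun x : TorusSite 4 N =>
          W < ∑ p, (if OnSeparator x s p.1 then ‖u p‖ ^ 2 else 0)).card : ℝ) ≤
        (∑ i : Fin 4, ∏ j ∈ Finset.univ.erase i, ((s j : ℝ) - 1)) * (∑ p, ‖u p‖ ^ 2) / W

/-- **A4 — exact translation averaging of the crux's probability.** The un-normalised phase-quenched
weight of an event is unchanged when the event is read on the translated configuration
(`wilsonMeasure_map_torusConfigShift`, `fermionDet_wilsonDirac_torusConfigShift`; the normalised
ratio `P` of the crux follows by dividing). Consequently `P(E) = (#sites)⁻¹ Σ_v P(E ∘ shift_v) =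
E_U[(#sites)⁻¹ #{v : E(shift_v U)}]` — the probability of a cell event equals the expected FRACTION
OF TRANSLATES of the cell on which it happens. Provable now from the two cited tree facts. -/
def PhaseQuenchedTranslationInvariance : Prop :=
  ∀ (N : ℕ) [NeZero N] (β : ℝ) (Nf : ℕ) (mq : Fin Nf → ℝ) (v : TorusSite 4 N)
    (E : GaugeConfig 4 N 𝔾 → Prop),
    (∫ U, (if E (torusConfigShift v U) then (1 : ℝ) else 0) *
        (∏ f, ‖fermionDet (wilsonDirac (fundamentalRep (Fin 3)) U (mq f) 1)‖)
        ∂(wilsonMeasure (d := 4) (L := N) (fundamentalRep (Fin 3)) β)) =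
      ∫ U, (if E U then (1 : ℝ) else 0) *
        (∏ f, ‖fermionDet (wilsonDirac (fundamentalRep (Fin 3)) U (mq f) 1)‖)
        ∂(wilsonMeasure (d := 4) (L := N) (fundamentalRep (Fin 3)) β)

/-! ## Card B — `coherent-roughness` -/

/-- A colour field `f` on site × colour is ALIGNED across the link `(y₀, μ)` under `U`: its colour
vector at `y₀ + μ̂` is a non-negative multiple of the parallel transport `ρ(U(y₀,μ))ᴴ f(y₀)` of its
colour vector at `y₀` (covariantly constant across the link — the local structure of a smooth
carrier, exact for the lowest free/pure-gauge modes). -/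
def IsAlignedAt {N : ℕ} (U : GaugeConfig 4 N 𝔾) (y₀ : TorusSite 4 N) (μ : Fin 4)
    (f : TorusSite 4 N × Fin 3 → ℂ) : Prop :=
  ∃ c : ℝ, 0 ≤ c ∧ ∀ b : Fin 3,
    f (Site.shift y₀ μ, b) = c * ∑ a, star ((fundamentalRep (Fin 3)) (U (y₀, μ)) a b) * f (y₀, a)

/-- **B1 — aligned-link monotonicity of the covariant hopping form (the sign-definite response).**
If `f` is aligned across `(y₀, μ)` under `U`, then replacing that ONE link by an arbitrary `g ∈ SU(3)`
can only LOWER the real part of the spin-blind covariant hopping form `Re⟨f, F_μ f⟩` (equivalently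
RAISE the Wilson energy `⟨f,(4 − A_U)f⟩` entering `KineticEdge`): the `y₀`-term changes from
`c‖f(y₀)‖²` to `c·Re⟨f(y₀), ρ(g)ρ(U(y₀,μ))⁻¹ f(y₀)⟩ ≤ c‖f(y₀)‖²` (unitary numerical range), all
other terms are untouched. So along ANY one-parameter deformation of links under an aligned mode
the crossing condition `⟨W_U⟩ = |μ'|` is pushed one way only: UV roughening lowers crossing
masses — a MONOTONE coupling, second order in the link angle (`d²/dθ² Re⟨v, ρ(e^{θX})v⟩|₀ =
⟨v, ρ(X)²v⟩ ≤ 0`), absent from the first-order (current) law of motion used so far. Provable now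
(`reindex_linkHop_kronecker_one_mulVec`-style entrywise expansion + `Matrix.unitaryGroup`
norm bound). -/
def AlignedLinkMonotone : Prop :=
  ∀ (N : ℕ) [NeZero N] (U : GaugeConfig 4 N 𝔾) (y₀ : TorusSite 4 N) (μ : Fin 4) (g : 𝔾)
    (f : TorusSite 4 N × Fin 3 → ℂ), IsAlignedAt U y₀ μ f →
    (∑ p, star (f p) *
        ((linkHop (fundamentalRep (Fin 3)) (Function.update U (y₀, μ) g) μ).mulVec f) p).re ≤
      (∑ p, star (f p) * ((linkHop (fundamentalRep (Fin 3)) U μ).mulVec f) p).re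

/-! ## Card C — `valence-mass-fubini` -/

/-- **C1 — isolation lemma (parity ⇒ counting for isolated sign changes).** Let `X` be the finite set
of sign-change points of a real function on the mass axis whose sign at `μ` is
`(−1)^{#(X ∩ (μ,∞))}` (for the separator factor: crossings of the box and of its children above `μ`).
A point `x ∈ X` with no other point within `Δ` OWNS a one-sided interval of length `Δ` on which the
count above is odd — i.e. on which the factor is NEGATIVE (a sign defect at every valence mass in
that interval). Pure combinatorics; provable now. -/
def IsolatedSignChangeOwnsInterval : Prop :=
  ∀ (X : Finset ℝ) (x Δ : ℝ), x ∈ X → 0 < Δ → (∀ x' ∈ X, x' ≠ x → Δ ≤ |x' - x|) →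
    (∀ μ ∈ Set.Ioo (x - Δ) x, Odd ((X.filter fun z => μ < z).card)) ∨
    (∀ μ ∈ Set.Ioo x (x + Δ), Odd ((X.filter fun z => μ < z).card))

/-- **C2 — a scale-`j ≥ 1` sign defect IS negativity of the separator factor.** With all sixteen
children determinants non-zero, `IsSignDefect U μ j s` (parent sign × children signs negative) is
exactly `Re (sepFactor U μ s) < 0` (`sepFactor = det D_c/∏ det D_child`, all determinants real by
route support `DirichletDetReal`). So clause (ii) of the hypothesis `NegativeCellsDilute` bounds,
at EVERY valence mass `m' > M₀`, the phase-quenched probability that the separator factor of a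
window box is negative at `m_crit + a_k m'/Z_m`. Provable now. -/
def SignDefectIffSepFactorNeg : Prop :=
  ∀ (N : ℕ) [NeZero N] (U : GaugeConfig 4 N 𝔾) (μ : ℝ) (j : ℕ) (s : Fin 4 → ℕ), 0 < j →
    (∀ ε, cellDetRe U μ (halfCorner s ε) (halfSides s ε) ≠ 0) →
    (IsSignDefect U μ j s ↔ (sepFactor U μ s).re < 0)

/-- **C3 — pointwise dilution integrates (dominated convergence in the valence mass).** The
hypothesis gives, for EACH renormalised valence mass `m'` separately, `P_k(defect at m') → 0` with
no uniformity in `m'`; since the probabilities are in `[0,1]`, the `m'`-INTEGRAL over any compact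
mass range still tends to `0`. With C1–C2 and Fubini: the expected total LENGTH (in renormalised
mass) of the negativity set of the separator factor over `[m₁−Δ, m₂+Δ]` tends to `0`, hence the
expected NUMBER of `Δ`-isolated sign changes (early crossers of the box or a child, isolated from
their partners) with valence location in `[m₁, m₂]` tends to `0` — from (ii) alone. Mathlib DCT. -/
def IntegratedDilutionVanishes : Prop :=
  ∀ (p : ℕ → ℝ → ℝ) (a b : ℝ), a ≤ b → (∀ k m, 0 ≤ p k m ∧ p k m ≤ 1) → (∀ k, Measurable (p k)) →
    (∀ m ∈ Set.Icc a b, Tendsto (fun k => p k m) atTop (nhds 0)) →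
    Tendsto (fun k => ∫ m in a..b, p k m) atTop (nhds 0)

/-- Sanity: C3 is a theorem (dominated convergence with the constant dominator `1` on `[a,b]`). -/
theorem integratedDilutionVanishes_holds : IntegratedDilutionVanishes := by
  intro p a b hab hp hmeas hpt
  have hbound : ∀ k, ∀ᵐ m ∂(volume : Measure ℝ), m ∈ Set.uIoc a b → ‖p k m‖ ≤ (1 : ℝ) := by
    intro k
    refine Filter.Eventually.of_forall fun m _ => ?_
    rw [Real.norm_eq_abs, abs_of_nonneg (hp k m).1]
    exact (hp k m).2
  have hlim : ∀ᵐ m ∂(volume : Measure ℝ), m ∈ Set.uIoc a b →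
      Tendsto (fun k => p k m) atTop (nhds ((fun _ => (0 : ℝ)) m)) := by
    refine Filter.Eventually.of_forall fun m hm => ?_
    rw [Set.uIoc_of_le hab] at hm
    exact hpt m ⟨hm.1.le, hm.2⟩
  have h := intervalIntegral.tendsto_integral_filter_of_dominated_convergence (μ := volume)
    (F := fun k m => p k m) (f := fun _ => (0 : ℝ)) (fun _ => (1 : ℝ))
    (Filter.Eventually.of_forall fun k => (hmeas k).aestronglyMeasurable)
    (Filter.Eventually.of_forall hbound) intervalIntegrable_const hlim
  simpa using h

end Summit.QuantumFields.QCD.Cruxes.CoerciveOfDilute.Ideator2
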